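import Literature.AnabelianGeometry.AbsoluteAnabelian.AbsTopIProp410iiiAssembly
import Literature.AnabelianGeometry.AbsoluteAnabelian.AbsTopI.CoFreeCompletionNhds
import HarnessLib

/-!
# [AbsTopI] Prop 4.10 (iii), row iii.L03 (the image of `Π^tp_X → Π^tp_Y`): the two inputs
# "same Galois image" and "`Δ^tp_X → Δ^tp_Y` dense" of the assembly REDUCED to their residues
# (proof-only)

S. Mochizuki, *Topics in Absolute Anabelian Geometry I: Generalities* [AbsTopI] (J. Math. Sci.
Univ. Tokyo 19 (2012)), §0 p. 8, Prop 4.10 (i)/(iii) p. 60, Def 4.2 (i)(c) p. 48 ("an open immersion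
`φ : X_j ↪ X_{j+1}` [so `k_j = k_{j+1}`] — i.e., a "de-cuspidalization""), Def 4.11 (i)(c) pp. 62–63 ("a dense homomorphism"); manuscript pagination, lit
key `paper:url-11ac98ba15fc`, read on the page.  Row iii.L03 of the cell's sub-DAG
`HOME/plan/L4/SUBDAG-AbsTopI-Prop410.md`: by L4-lead RULING #3f the printed property of the tempered
`f` is DENSITY (`DeCuspidalization.Dense`), and the assembly `prop410iiiAt_of_rows'`
(`AbsTopIProp410iiiAssembly.lean`, abc-iut-L4-t13 gen 4) consumes exactly two iii.L03-type inputs: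
`hrange` (same Galois image of `X` and `Y`) and `hdense : DenseRange E.fDelta` (Δ-level density).

* `hrange` ⟺ `G_{k,X} = G_{k,Y}` as subgroups of `G_{ℚ_p}` (`exists_aug_eq_iff_GK_eq`), in
  particular it follows from the SAME BASE FIELD `X.K = Y.K` (`exists_aug_eq_of_K_eq`; Def 4.2 (i)(c)
  p. 48: "[so `k_j = k_{j+1}`]"; the structure `DeCuspidalization` records `f` over `G_{ℚ_p}`
  only, so the clause is an input).
* `hdense`.  Under Prop 4.10 (i) for `Y` AT THE CONSTRUCTION (`SelfCompletionAt Y`: the topology of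
  `Π^tp_Y` IS the inverse-limit topology of the `Π^tp_Y ⧸ K_{H′}`, v2) density of `Δ^tp_X → Δ^tp_Y`
  FOLLOWS from the group-theoretic residue "`Δ^tp_Y = f(Δ^tp_X) · K_{H′}` for every Y-index `H′`"
  (`denseRange_fDelta_of_le_sup_piKer`), a fortiori from "`Δ^tp_Y = f(Δ^tp_X) · H′^{co-fr}`"
  (`…_of_le_sup_cofreeCore`); CONVERSELY density and §0 p. 8's standing hypothesis for `H′` give that
  residue back (`le_sup_cofreeCore_of_denseRange_fDelta`), whence `denseRange_fDelta_iff`.  The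
  residue SPLITS (`le_sup_cofreeCore_iff`) into (R1) `Δ^tp_Y = f(Δ^tp_X) · H′` (surjectivity onto the
  FINITE quotients `Δ^tp_Y/H′ = Gal(Y_{H′}/Y_{k̄})`) and (R2) `H′ = f(f⁻¹H′) · H′^{co-fr}` (surjectivity
  of `π₁(Γ_{X_{f⁻¹H′}}) → π₁(Γ_{Y_{H′}})` — the SURJECTIVE half of "filling in a cusp does not change
  the dual graph", companion of the pullback form of row iii.L04, `AbsTopIProp410CompatProofs.lean`);
  and (R1) is a THEOREM at genuine data (companion file `AbsTopIProp410FiniteLevelProofs.lean`: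
  from `Δ_Y ⊆ f̂(Δ_X)` and `IsProfiniteCompletion Y.deltaToHat`, both available from abc-iut-L3's
  parameter bundles `GroupLevelData`).  So the honest residue of row iii.L03 is (R2).

Inputs are hypotheses stated in the signatures (no new named facts; FACT-LIST untouched).
HONEST FRAMING: refereed prerequisite paper; nothing here bears on [IUTchIII] Cor 3.12; typed ≠ proved.
-/

noncomputable section

open _root_.Topology Filter

namespace Literature.AnabelianGeometry.AbsoluteAnabelian.AbsTopI.Prop410

open Literature.AnabelianGeometry.SemiGraphs
open Literature.AnabelianGeometry.AbsoluteAnabelian.AbsTopI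

variable {p : ℕ} [Fact p.Prime]

/-! ### Same Galois image -/

/-- **`hrange` ⟺ same Galois group**: `X` and `Y` have the same Galois image
(`∀ y ∃ g, aug_X g = aug_Y y`) iff `G_{k,X} = G_{k,Y}` inside `G_{ℚ_p}` (one inclusion is the field
`aug_comp`: `f` lies over `G_{ℚ_p}`). [cite: MochizukiAbsTopI2012, Def 4.2 (i) p.48] -/
theorem exists_aug_eq_iff_GK_eq {X Y : TemperedCurve p} (E : DeCuspidalization X Y) :
    (∀ y : Y.PiTemp, ∃ g : X.PiTemp, X.aug g = Y.aug y) ↔ X.GK = Y.GK := by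
  rw [TemperedCurve.GK, TemperedCurve.GK, ← X.range_aug, ← Y.range_aug]
  constructor
  · intro h
    refine le_antisymm ?_ ?_
    · rintro _ ⟨g, rfl⟩
      exact ⟨E.f g, E.aug_comp g⟩
    · rintro _ ⟨y, rfl⟩
      obtain ⟨g, hg⟩ := h y
      exact ⟨g, hg⟩
  · intro h y
    have hy : Y.aug y ∈ X.aug.toMonoidHom.range := by
      rw [h]
      exact ⟨y, rfl⟩
    obtain ⟨g, hg⟩ := hy
    exact ⟨g, hg⟩

/-- **`hrange` from the same base field** ([AbsTopI] Def 4.2 (i)(c) p. 48: a de-cuspidalization is "an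
open immersion `φ : X_j ↪ X_{j+1}` [so `k_j = k_{j+1}`]"): `X.K = Y.K` ⟹ `∀ y ∃ g, aug_X g = aug_Y y`.
[cite: MochizukiAbsTopI2012, Def 4.2 (i) p.48] -/
theorem exists_aug_eq_of_K_eq {X Y : TemperedCurve p} (hK : X.K = Y.K) (y : Y.PiTemp) :
    ∃ g : X.PiTemp, X.aug g = Y.aug y := by
  have hy : Y.aug y ∈ X.aug.toMonoidHom.range := by
    rw [X.range_aug, hK, ← Y.range_aug]
    exact ⟨y, rfl⟩
  obtain ⟨g, hg⟩ := hy
  exact ⟨g, hg⟩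

/-! ### The topology of `Π^tp_Y` under Prop 4.10 (i) at the construction -/

/-- `Δ` itself is an index of the `(Q, Δ)`-co-free completion (the index set is nonempty).
[cite: MochizukiAbsTopI2012, §0 p.8] -/
theorem nonempty_charOpenSubgroup {P : Type*} [Group P] [TopologicalSpace P] (Δ : Subgroup P) :
    Nonempty (CharOpenSubgroup Δ) :=
  ⟨{ toSubgroup := Δ
     le := le_rfl
     isOpen := by
       rw [Subgroup.subgroupOf_self, Subgroup.coe_top]
       exact isOpen_univ
     finiteIndex := by
       rw [Subgroup.subgroupOf_self]
       infer_instance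
     map_eq := fun α => by
       rw [Subgroup.subgroupOf_self]
       exact Subgroup.map_top_of_surjective _ α.surjective }⟩

/-- **Under `SelfCompletionAt Y` every neighbourhood in `Π^tp_Y` contains a "`K_{H′}`-saturated"
neighbourhood**: if `t ∈ 𝓝 y` then for some Y-index `H′` and some neighbourhood `V` of the class of `y`
in `Π^tp_Y ⧸ K_{H′}` (quotient topology), every `z` whose class lies in `V` lies in `t` — because (i)
makes `Π^tp_Y → (Π^tp_Y)^{Π̂_Y/co-fr}` a homeomorphism onto the v2 inverse-limit topology
(`CoFreeCompletion.mem_nhds_iff`). [cite: MochizukiAbsTopI2012, Prop 4.10 (i) p.60] -/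
theorem SelfCompletionAt.exists_nhds_piKer {Y : TemperedCurve p} (hY : SelfCompletionAt Y)
    {y : Y.PiTemp} {t : Set Y.PiTemp} (ht : t ∈ 𝓝 y) :
    ∃ (H : CharOpenSubgroup Y.DeltaTemp)
      (V : Set (Y.PiTemp ⧸ CoFreeCompletion.piKer
        ((ContinuousMonoidHom.id Y.PiHat).comp Y.toHat) Y.DeltaTemp H)),
      V ∈ 𝓝 (y : Y.PiTemp ⧸ CoFreeCompletion.piKer
        ((ContinuousMonoidHom.id Y.PiHat).comp Y.toHat) Y.DeltaTemp H) ∧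
      ∀ z : Y.PiTemp, (z : Y.PiTemp ⧸ CoFreeCompletion.piKer
        ((ContinuousMonoidHom.id Y.PiHat).comp Y.toHat) Y.DeltaTemp H) ∈ V → z ∈ t := by
  haveI := nonempty_charOpenSubgroup Y.DeltaTemp
  obtain ⟨e, he⟩ := hY
  have he' : ∀ g : Y.PiTemp,
      e (toCoFreeCompletion ((ContinuousMonoidHom.id Y.PiHat).comp Y.toHat) Y.DeltaTemp g) = g := he
  -- `e ∘ η = id`, so `e ⁻¹' t` is a neighbourhood of `η y`
  have ht' : ⇑e ⁻¹' t ∈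
      𝓝 (toCoFreeCompletion ((ContinuousMonoidHom.id Y.PiHat).comp Y.toHat) Y.DeltaTemp y) := by
    refine (map_continuous e).continuousAt.preimage_mem_nhds ?_
    rw [he' y]
    exact ht
  obtain ⟨H, V, hV, hsub⟩ := (CoFreeCompletion.mem_nhds_iff _ _).mp ht'
  refine ⟨H, V, ?_, fun z hz => ?_⟩
  · rwa [kerCoord_toCoFreeCompletion] at hV
  · have hz' : toCoFreeCompletion ((ContinuousMonoidHom.id Y.PiHat).comp Y.toHat) Y.DeltaTemp z ∈
        CoFreeCompletion.kerCoord H ⁻¹' V := by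
      rw [Set.mem_preimage, kerCoord_toCoFreeCompletion]
      exact hz
    have ht₂ :
        e (toCoFreeCompletion ((ContinuousMonoidHom.id Y.PiHat).comp Y.toHat) Y.DeltaTemp z) ∈ t :=
      hsub hz'
    rwa [he' z] at ht₂

/-! ### Row iii.L03 (density) from and to the graph-level residue -/

/-- **Density of `Δ^tp_X → Δ^tp_Y` from (i) for `Y` and "`Δ^tp_Y = f(Δ^tp_X) · K_{H′}` for every
Y-index `H′`"**: a neighbourhood of `y ∈ Δ^tp_Y` contains a `K_{H′}`-saturated one; writing
`y = f(d) · k` (`d ∈ Δ^tp_X`, `k ∈ K_{H′}`), `f(d)` has the same class as `y`, so lies in it.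
[cite: MochizukiAbsTopI2012, Prop 4.10 (iii) p.60] -/
theorem denseRange_fDelta_of_le_sup_piKer {X Y : TemperedCurve p} (E : DeCuspidalization X Y)
    (hY : SelfCompletionAt Y)
    (hsurj : ∀ H' : CharOpenSubgroup Y.DeltaTemp,
      Y.DeltaTemp ≤ X.DeltaTemp.map E.f.toMonoidHom ⊔
        CoFreeCompletion.piKer ((ContinuousMonoidHom.id Y.PiHat).comp Y.toHat) Y.DeltaTemp H') :
    DenseRange E.fDelta := by
  intro y
  rw [closure_subtype, mem_closure_iff_nhds]
  intro t ht
  obtain ⟨H, V, hV, hsub⟩ := hY.exists_nhds_piKer ht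
  -- `y = f(d) · k` with `d ∈ Δ^tp_X`, `k ∈ K_H`
  have hy : (y : Y.PiTemp) ∈ ((X.DeltaTemp.map E.f.toMonoidHom ⊔
      CoFreeCompletion.piKer ((ContinuousMonoidHom.id Y.PiHat).comp Y.toHat) Y.DeltaTemp H :
        Subgroup Y.PiTemp) : Set Y.PiTemp) := hsurj H y.2
  rw [Subgroup.mul_normal] at hy
  obtain ⟨a, ha, k, hk, hak⟩ := Set.mem_mul.mp hy
  obtain ⟨d, hd, rfl⟩ := ha
  refine ⟨E.f.toMonoidHom d, hsub _ ?_, ⟨E.fDelta ⟨d, hd⟩, ⟨⟨d, hd⟩, rfl⟩, rfl⟩⟩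
  have hcl : ((E.f.toMonoidHom d : Y.PiTemp) : Y.PiTemp ⧸
      CoFreeCompletion.piKer ((ContinuousMonoidHom.id Y.PiHat).comp Y.toHat) Y.DeltaTemp H) =
        ((y : Y.PiTemp) : Y.PiTemp ⧸
          CoFreeCompletion.piKer ((ContinuousMonoidHom.id Y.PiHat).comp Y.toHat) Y.DeltaTemp H) := by
    rw [QuotientGroup.eq, ← hak, inv_mul_cancel_left]
    exact hk
  rw [hcl]
  exact mem_of_mem_nhds hV

/-- **Density of `Δ^tp_X → Δ^tp_Y` from (i) for `Y` and the graph-level residue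
"`Δ^tp_Y = f(Δ^tp_X) · H′^{co-fr}` for every Y-index `H′`"** (`H′^{co-fr} ⊆ K_{H′}`).
[cite: MochizukiAbsTopI2012, Prop 4.10 (iii) p.60] -/
theorem denseRange_fDelta_of_le_sup_cofreeCore {X Y : TemperedCurve p} (E : DeCuspidalization X Y)
    (hY : SelfCompletionAt Y)
    (hsurj : ∀ H' : CharOpenSubgroup Y.DeltaTemp,
      Y.DeltaTemp ≤ X.DeltaTemp.map E.f.toMonoidHom ⊔ cofreeCore H'.toSubgroup) :
    DenseRange E.fDelta :=
  denseRange_fDelta_of_le_sup_piKer E hY fun H' =>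
    (hsurj H').trans (sup_le_sup_left (cofreeCore_le_ker_toCoFreeQuot _ H'.toSubgroup) _)

/-- **Conversely, density gives the graph-level residue back** under §0 p. 8's standing hypothesis
for `H′` ("admits a minimal co-free subgroup", so `H′^{co-fr}` is OPEN in `Δ^tp_Y`): the open coset
`y · H′^{co-fr}` meets `f(Δ^tp_X)`. [cite: MochizukiAbsTopI2012, §0 p.8] -/
theorem le_sup_cofreeCore_of_denseRange_fDelta {X Y : TemperedCurve p} (E : DeCuspidalization X Y)
    (hdense : DenseRange E.fDelta) (H' : CharOpenSubgroup Y.DeltaTemp) {M : Subgroup Y.PiTemp}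
    (hM : IsMinimalCofreeIn H'.toSubgroup M) :
    Y.DeltaTemp ≤ X.DeltaTemp.map E.f.toMonoidHom ⊔ cofreeCore H'.toSubgroup := by
  intro y hy
  have hopen : IsOpen (((cofreeCore H'.toSubgroup).subgroupOf Y.DeltaTemp : Subgroup Y.DeltaTemp) :
      Set Y.DeltaTemp) := isOpen_cofreeCore_subgroupOf H' hM
  let y₁ : Y.DeltaTemp := ⟨y, hy⟩
  have hcoset : IsOpen ((fun z : Y.DeltaTemp => y₁ * z) ''
      (((cofreeCore H'.toSubgroup).subgroupOf Y.DeltaTemp : Subgroup Y.DeltaTemp) :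
        Set Y.DeltaTemp)) := (Homeomorph.mulLeft y₁).isOpenMap _ hopen
  have hne : ((fun z : Y.DeltaTemp => y₁ * z) ''
      (((cofreeCore H'.toSubgroup).subgroupOf Y.DeltaTemp : Subgroup Y.DeltaTemp) :
        Set Y.DeltaTemp)).Nonempty := ⟨y₁ * 1, 1, Subgroup.one_mem _, rfl⟩
  obtain ⟨d, hd⟩ := hdense.exists_mem_open hcoset hne
  obtain ⟨m, hm, hmeq⟩ := hd
  have hm' : (m : Y.PiTemp) ∈ cofreeCore H'.toSubgroup := Subgroup.mem_subgroupOf.mp hm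
  have hfd : E.f (d : X.PiTemp) = y * (m : Y.PiTemp) := by
    have h := congrArg Subtype.val hmeq
    rw [DeCuspidalization.coe_fDelta_apply] at h
    exact h.symm
  have hy' : y = E.f (d : X.PiTemp) * (m : Y.PiTemp)⁻¹ := by
    rw [hfd, mul_inv_cancel_right]
  rw [hy']
  exact Subgroup.mul_mem_sup ⟨(d : X.PiTemp), d.2, rfl⟩ (Subgroup.inv_mem _ hm')

/-- **Row iii.L03 (density of `Δ^tp_X → Δ^tp_Y`) ⟺ the graph-level residue**, under (i) for `Y` and
§0 p. 8's standing hypothesis for the Y-indices. [cite: MochizukiAbsTopI2012, Prop 4.10 (iii) p.60] -/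
theorem denseRange_fDelta_iff {X Y : TemperedCurve p} (E : DeCuspidalization X Y)
    (hY : SelfCompletionAt Y)
    (hmin : ∀ H' : CharOpenSubgroup Y.DeltaTemp, ∃ M, IsMinimalCofreeIn H'.toSubgroup M) :
    DenseRange E.fDelta ↔
      ∀ H' : CharOpenSubgroup Y.DeltaTemp,
        Y.DeltaTemp ≤ X.DeltaTemp.map E.f.toMonoidHom ⊔ cofreeCore H'.toSubgroup := by
  constructor
  · intro h H'
    obtain ⟨M, hM⟩ := hmin H'
    exact le_sup_cofreeCore_of_denseRange_fDelta E h H' hM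
  · exact denseRange_fDelta_of_le_sup_cofreeCore E hY

/-! ### Splitting the residue: finite level (R1) and graph level (R2) -/

/-- **The residue splits**: "`Δ^tp_Y = f(Δ^tp_X) · H′^{co-fr}`" ⟺ (R1) "`Δ^tp_Y = f(Δ^tp_X) · H′`"
(surjectivity onto the finite quotient `Δ^tp_Y/H′`) ∧ (R2) "`H′ = f(f⁻¹H′) · H′^{co-fr}`" (surjectivity
of `f⁻¹H′ → H′/H′^{co-fr}`, i.e. onto `π₁` of the dual graph of `Y_{H′}` — the surjective half of
"filling in a cusp does not change the dual graph"). [cite: MochizukiAbsTopI2012, Prop 4.10 (iii) p.60] -/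
theorem le_sup_cofreeCore_iff {X Y : TemperedCurve p} (E : DeCuspidalization X Y)
    (H' : CharOpenSubgroup Y.DeltaTemp) :
    Y.DeltaTemp ≤ X.DeltaTemp.map E.f.toMonoidHom ⊔ cofreeCore H'.toSubgroup ↔
      Y.DeltaTemp ≤ X.DeltaTemp.map E.f.toMonoidHom ⊔ H'.toSubgroup ∧
        H'.toSubgroup ≤ (H'.toSubgroup.comap E.f.toMonoidHom).map E.f.toMonoidHom ⊔
          cofreeCore H'.toSubgroup := by
  haveI : Y.DeltaTemp.Normal := by
    unfold TemperedCurve.DeltaTemp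
    infer_instance
  haveI : (cofreeCore H'.toSubgroup).Normal := cofreeCore_normal_of_charOpen H'
  haveI : H'.toSubgroup.Normal := H'.normal
  constructor
  · intro h
    refine ⟨h.trans (sup_le_sup_left (cofreeCore_le _) _), fun x hx => ?_⟩
    have hx' : x ∈ ((X.DeltaTemp.map E.f.toMonoidHom ⊔ cofreeCore H'.toSubgroup :
        Subgroup Y.PiTemp) : Set Y.PiTemp) := h (H'.le hx)
    rw [Subgroup.mul_normal] at hx'
    obtain ⟨a, ha, c, hc, hac⟩ := Set.mem_mul.mp hx'
    obtain ⟨g, -, rfl⟩ := ha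
    -- `f g = x c⁻¹ ∈ H′`, so `g ∈ f⁻¹H′`
    have hfg : E.f.toMonoidHom g ∈ H'.toSubgroup := by
      have : E.f.toMonoidHom g = x * c⁻¹ := by rw [← hac, mul_inv_cancel_right]
      rw [this]
      exact Subgroup.mul_mem _ hx (Subgroup.inv_mem _ (cofreeCore_le _ hc))
    rw [← hac]
    exact Subgroup.mul_mem_sup ⟨g, hfg, rfl⟩ hc
  · rintro ⟨h1, h2⟩ y hy
    have hy' : y ∈ ((X.DeltaTemp.map E.f.toMonoidHom ⊔ H'.toSubgroup : Subgroup Y.PiTemp) :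
        Set Y.PiTemp) := h1 hy
    rw [Subgroup.mul_normal] at hy'
    obtain ⟨a, ha, x, hx, hax⟩ := Set.mem_mul.mp hy'
    obtain ⟨g, hg, rfl⟩ := ha
    have hx' : x ∈ (((H'.toSubgroup.comap E.f.toMonoidHom).map E.f.toMonoidHom ⊔
        cofreeCore H'.toSubgroup : Subgroup Y.PiTemp) : Set Y.PiTemp) := h2 hx
    rw [Subgroup.mul_normal] at hx'
    obtain ⟨b, hb, c, hc, hbc⟩ := Set.mem_mul.mp hx'
    obtain ⟨g', hg', rfl⟩ := hb
    rw [← hax, ← hbc, ← mul_assoc, ← map_mul]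
    exact Subgroup.mul_mem_sup
      ⟨g * g', Subgroup.mul_mem _ hg (E.comap_le_deltaTemp H'.le hg'), rfl⟩ hc

end Literature.AnabelianGeometry.AbsoluteAnabelian.AbsTopI.Prop410

end
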